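import Mathlib
import Summits.QuantumAdvantage.QuantumAdvantage.Theorems.MobiusLadderQuadraticDigitPhasesStubCondCount

/-!
# Chain counting — helper for the crux `MobiusLadder.QuadraticDigitPhases` (stmt-QuantumAdvantage-1391), line `Sketch`

A generalisation of the landed conditional window counting `stub_condCount` (p125201) needed by the
peeling argument of the cell core (Lines/Sketch.md §3.9): the events `E j` are read off increasing,
pairwise disjoint bit ranges `[lo j, hi j)` of the input `T < 2^N` (event `j` depends only on the bits
below `hi j`), and the hypothesis is the AVERAGED one — for every prefix `P < 2^(lo j)` at most a
`(1 - c)`-fraction of the `2^(hi j - lo j)` continuations satisfies `E j` — instead of a bound for every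
setting of the bits outside a fixed-length window.  This is the form in which "constants decided by later
bits through a mixing buffer" (members of a flip combination lying above its pivot column) are handled:
the range of event `j` runs from its counting window up to the last bit it depends on.
-/

set_option linter.dupNamespace false -- D-0017: single-problem summit ⇒ `QuantumAdvantage.QuantumAdvantage` by design

namespace Summit.QuantumAdvantage.QuantumAdvantage.Theorems.MobiusLadderQuadraticDigitPhasesStubChainCount

open Finset
open Summit.QuantumAdvantage.QuantumAdvantage.Theorems.MobiusLadderQuadraticDigitPhasesStubCondCount
  (window_count sub_window add_mul_mod_of_dvd)

/-- **Chain counting.**  `d` Boolean events `E j` on inputs `T < 2^N`; event `j` depends only on the bits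
below `hi j`; the ranges `[lo j, hi j)` are increasing (`hi i ≤ lo j` for `i < j`) inside `[0, N]`; and for
every prefix `P < 2^(lo j)` at most `(1 - c) · 2^(hi j - lo j)` of the continuations `P + 2^(lo j) · u`,
`u < 2^(hi j - lo j)`, satisfy `E j`.  Then at most `(1 - c)^d · 2^N` inputs satisfy every event. -/
theorem stub_chainCount :
    ∀ (N d : ℕ) (c : ℝ) (lo hi : Fin d → ℕ) (E : Fin d → ℕ → Bool),
      (∀ j, lo j ≤ hi j ∧ hi j ≤ N) → (∀ i j : Fin d, i < j → hi i ≤ lo j) →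
      (∀ j, ∀ T T' : ℕ, T % 2 ^ (hi j) = T' % 2 ^ (hi j) → E j T = E j T') →
      (∀ j, ∀ P : ℕ, P < 2 ^ (lo j) → (((Finset.range (2 ^ (hi j - lo j))).filter (fun u =>
          E j (P + 2 ^ (lo j) * u) = true)).card : ℝ) ≤ (1 - c) * (2 : ℝ) ^ (hi j - lo j)) →
      (((Finset.range (2 ^ N)).filter (fun T => ∀ j, E j T = true)).card : ℝ) ≤ (1 - c) ^ d * (2 : ℝ) ^ N := by
  intro N d c
  induction d with
  | zero =>
    intro lo hi E _ _ _ _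
    rw [pow_zero, one_mul]
    calc (((range (2 ^ N)).filter (fun T => ∀ j, E j T = true)).card : ℝ)
        ≤ ((range (2 ^ N)).card : ℝ) := by exact_mod_cast card_filter_le _ _
      _ = 2 ^ N := by rw [card_range, Nat.cast_pow, Nat.cast_ofNat]
  | succ d ih =>
    intro lo hi E h1 h2 h3 h4
    obtain ⟨hlh, hN⟩ := h1 (Fin.last d)
    have hB : 0 < 2 ^ lo (Fin.last d) := by positivity
    have hM : 0 < 2 ^ (hi (Fin.last d) - lo (Fin.last d)) := by positivity
    have hc : 0 ≤ 1 - c :=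
      nonneg_of_mul_nonneg_left ((Nat.cast_nonneg _).trans (h4 (Fin.last d) 0 hB)) (by positivity)
    have ih' := ih (fun i => lo i.castSucc) (fun i => hi i.castSucc) (fun i => E i.castSucc)
      (fun j => h1 _) (fun i j hij => h2 _ _ (Fin.castSucc_lt_castSucc_iff.2 hij)) (fun j => h3 _)
      (fun j => h4 _)
    have hpow : 2 ^ (N - hi (Fin.last d)) * 2 ^ (hi (Fin.last d) - lo (Fin.last d)) *
        2 ^ lo (Fin.last d) = 2 ^ N := by
      rw [← pow_add, ← pow_add]
      congr 1
      omega
    have hMB : 2 ^ (hi (Fin.last d) - lo (Fin.last d)) * 2 ^ lo (Fin.last d) =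
        2 ^ hi (Fin.last d) := by
      rw [← pow_add]
      congr 1
      omega
    have key : (((range (2 ^ N)).filter (fun T => (∀ i : Fin d, E i.castSucc T = true) ∧
        E (Fin.last d) T = true)).card : ℝ) ≤
        (1 - c) * ((range (2 ^ N)).filter (fun T => ∀ i : Fin d, E i.castSucc T = true)).card := by
      rw [← hpow]
      refine window_count (2 ^ lo (Fin.last d)) (2 ^ (hi (Fin.last d) - lo (Fin.last d)))
        (2 ^ (N - hi (Fin.last d))) hB hM c (fun T => ∀ i : Fin d, E i.castSucc T = true)
        (fun T => E (Fin.last d) T = true) (fun Z w => forall_congr' fun i => ?_) (fun T => ?_)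
      · have hi : hi i.castSucc ≤ lo (Fin.last d) :=
          h2 i.castSucc (Fin.last d) (Fin.castSucc_lt_last i)
        rw [h3 i.castSucc (Z + w * 2 ^ lo (Fin.last d)) Z
          (add_mul_mod_of_dvd Z w _ _ (Nat.pow_dvd_pow 2 hi))]
      · have hP : T % 2 ^ lo (Fin.last d) < 2 ^ lo (Fin.last d) := Nat.mod_lt _ hB
        have heq : ((range (2 ^ (hi (Fin.last d) - lo (Fin.last d)))).filter (fun w =>
            E (Fin.last d) (T - T / 2 ^ lo (Fin.last d) % 2 ^ (hi (Fin.last d) - lo (Fin.last d)) *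
              2 ^ lo (Fin.last d) + w * 2 ^ lo (Fin.last d)) = true)) =
            ((range (2 ^ (hi (Fin.last d) - lo (Fin.last d)))).filter (fun u =>
              E (Fin.last d) (T % 2 ^ lo (Fin.last d) + 2 ^ lo (Fin.last d) * u) = true)) := by
          refine filter_congr (fun w _ => ?_)
          rw [sub_window T (2 ^ lo (Fin.last d)) (2 ^ (hi (Fin.last d) - lo (Fin.last d)))]
          rw [h3 (Fin.last d) (T / 2 ^ lo (Fin.last d) / 2 ^ (hi (Fin.last d) - lo (Fin.last d)) *
              2 ^ (hi (Fin.last d) - lo (Fin.last d)) * 2 ^ lo (Fin.last d) + T % 2 ^ lo (Fin.last d) +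
              w * 2 ^ lo (Fin.last d)) (T % 2 ^ lo (Fin.last d) + 2 ^ lo (Fin.last d) * w) ?_]
          rw [show T / 2 ^ lo (Fin.last d) / 2 ^ (hi (Fin.last d) - lo (Fin.last d)) *
              2 ^ (hi (Fin.last d) - lo (Fin.last d)) * 2 ^ lo (Fin.last d) + T % 2 ^ lo (Fin.last d) +
              w * 2 ^ lo (Fin.last d) =
              (T % 2 ^ lo (Fin.last d) + 2 ^ lo (Fin.last d) * w) +
                2 ^ hi (Fin.last d) * (T / 2 ^ lo (Fin.last d) / 2 ^ (hi (Fin.last d) - lo (Fin.last d))) by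
            rw [← hMB]; ring]
          rw [Nat.add_mul_mod_self_left]
        rw [heq]
        have := h4 (Fin.last d) (T % 2 ^ lo (Fin.last d)) hP
        rw [Nat.cast_pow, Nat.cast_ofNat]
        exact this
    have hfilter : (range (2 ^ N)).filter (fun T => ∀ j, E j T = true) =
        (range (2 ^ N)).filter (fun T => (∀ i : Fin d, E i.castSucc T = true) ∧
          E (Fin.last d) T = true) :=
      filter_congr (fun T _ => Fin.forall_fin_succ')
    rw [hfilter]
    calc _ ≤ _ := key
      _ ≤ (1 - c) * ((1 - c) ^ d * 2 ^ N) := mul_le_mul_of_nonneg_left ih' hc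
      _ = (1 - c) ^ (d + 1) * 2 ^ N := by ring

end Summit.QuantumAdvantage.QuantumAdvantage.Theorems.MobiusLadderQuadraticDigitPhasesStubChainCount
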